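import Literature.AlgebraicGeometry.HodgeTheory.AbelianVarietyCupPowersFactorialDivisibility
import HarnessLib

/-!
# Cup squares with INTEGRAL coefficients in all degrees on a complex abelian variety: `x ⌣ x = 0` for `deg x` odd and
# `x ⌣ x ∈ 2·H^{2k}(A(ℂ); ℤ)` for every `x ∈ Hᵏ(A(ℂ); ℤ)`, `k ≥ 1`, on the ALGEBRAIC Betti carrier

Layer `Literature/AlgebraicGeometry/HodgeTheory`, namespace `Literature.AlgebraicGeometry.HodgeTheory` (theorems about `A(ℂ)` in the
`AbelianVariety` namespace).  THEOREMS ONLY (no definition, no named fact, net debt 0).  Ring-level companion of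
`AbelianVarietyMiddleIntersectionLatticeEven` (the middle-degree PAIRING is even), `AbelianVarietyCupPowersFactorialDivisibility` (degree-two
classes: `cʲ ∈ j!·H^{2j}`) and `AbelianVarietyFieldCoefficientsCupSquares` (field coefficients): here `ℤ`-coefficients, every degree, the
square itself.  `H•(A(ℂ); ℤ) = ⋀• H¹(A(ℂ); ℤ)` (Hatcher Example 3.16; Lange Lemma 1.1.17): a class of odd degree squares to zero, and a class
`x = Σ aᵢ mᵢ` of even degree `k ≥ 2` written in cup monomials `mᵢ` (each of square zero, pairwise commuting) has
`x ⌣ x = 2 Σ_{i<j} aᵢ aⱼ mᵢ ⌣ mⱼ ∈ 2·H^{2k}(A(ℂ); ℤ)`.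

A. Hatcher, *Algebraic Topology* (2002), §3.2 Thm. 3.11 (graded commutativity `α ⌣ β = (−1)^{kℓ} β ⌣ α`) and Example 3.16
(`H*(Tⁿ; ℤ) = Λ_ℤ[α₁, …, α_n]`, exterior algebra: `αᵢ² = 0`); H. Lange, *Abelian Varieties over the Complex Numbers* (2023), §1.1.3
Lemma 1.1.17 and Exercise 1.1.6 (7) (`Hⁿ(X, ℤ) ≅ ⋀ⁿ H¹(X, ℤ)` compatibly with the cup product).

## What is proved

* §0 any space, any commutative coefficient ring: `cupProduct_add_cupProduct_swap_eq_zero_of_odd` (`a ⌣ b + b ⌣ a = 0`, `deg a`, `deg b` odd),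
  `cupProduct_self_add_self_eq_zero_of_odd` (`v ⌣ v + v ⌣ v = 0`, `deg v` odd); a private closure lemma turning `span ℤ S = ⊤` on a carrier
  with ANY `Module ℤ` structure (e.g. `ModuleCat`'s) into additive induction (`Subsingleton (Module ℤ ·)`);
* §1 `A(ℂ)`, `ℤ`-coefficients: **`cupProduct_self_eq_zero_of_odd_int`** (`x ⌣ x = 0`, `deg x` odd — `Hᵉᵛᵉⁿ(A(ℂ); ℤ)` is torsion-free);
  **`exists_cupProduct_self_eq_two_nsmul_int`** (`x ⌣ x = 2y` for every `x ∈ Hᵏ(A(ℂ); ℤ)`, `k ≥ 1`); `exists_cupProduct_sq_sq_eq_eight_nsmul_int`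
  (`(x ⌣ x) ⌣ (x ⌣ x) = 8z`);
* §2 pairings: `two_dvd_kroneckerPairing_cupProduct_self` (`2 ∣ ⟨x ⌣ x, σ⟩` for every `σ ∈ H_{2k}(A(ℂ); ℤ)`), `two_dvd_cupPairing_self`
  (`2 ∣ ⟨x ⌣ x, [A(ℂ)]_μ⟩`, complementary degree, every orientation), `eight_dvd_kroneckerPairing_cupProduct_sq_sq`.

## References

* [HatcherAT2002] A. Hatcher, *Algebraic Topology*, CUP 2002 — §3.2 Thm. 3.11, Example 3.16; §3.3 p. 250.
* [Lange2023AbelianVarietiesComplex] H. Lange, *Abelian Varieties over the Complex Numbers*, Springer 2023 — §1.1.3 Lemma 1.1.17 (b), Exercise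
  1.1.6 (7) (PDF pp. 23, 27).
* [MumfordAV1970] D. Mumford, *Abelian Varieties* (1970) — §1 (3)–(4).

## Provenance
Lane `lit-hodgefound` (Hodge path, Track 2), prover seat `lit-hodgefound-p21` (generation 43), self-proposed row g43-#7 (CLAIM BY PATH).
-/

noncomputable section

open Module Function
open Literature.AlgebraicTopology.SingularHomology
open Literature.Topology.FourManifolds

universe u v

namespace Literature.AlgebraicGeometry.HodgeTheory

open Literature.AlgebraicGeometry.Motives (AbelianVariety ComplexPoints IsSmoothProjective)

/-! ### §0 Any space, any ring: odd-degree classes anticommute; additive induction from `span ℤ S = ⊤` -/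

section CupAlgebra

variable {R : Type v} [CommRing R] {Y : Type u} [TopologicalSpace Y]

/-- **Classes of odd degrees anticommute: `a ⌣ b + b ⌣ a = 0`** for `deg a`, `deg b` odd (graded commutativity `a ⌣ b = (−1)^{pq} b ⌣ a`, Hatcher
Thm. 3.11, the tree's `cupProduct_gradedComm_holds`). [cite: HatcherAT2002, §3.2 Thm. 3.11] -/
theorem cupProduct_add_cupProduct_swap_eq_zero_of_odd {p q n : ℕ} (hp : Odd p) (hq : Odd q) (h : p + q = n) (h' : q + p = n)
    (a : singularCohomology R R Y p) (b : singularCohomology R R Y q) : cupProduct h a b + cupProduct h' b a = 0 := by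
  have hc := cupProduct_gradedComm_holds R Y h h' a b
  rw [Odd.neg_one_pow (hp.mul hq), neg_smul, one_smul] at hc
  rw [hc]
  exact neg_add_cancel _

/-- **`v ⌣ v + v ⌣ v = 0` for a class of odd degree**, any commutative coefficient ring (`v ⌣ v = -(v ⌣ v)`). [cite: HatcherAT2002, §3.2 Thm. 3.11] -/
theorem cupProduct_self_add_self_eq_zero_of_odd {k n : ℕ} (hk : Odd k) (h : k + k = n) (v : singularCohomology R R Y k) :
    cupProduct h v v + cupProduct h v v = 0 :=
  cupProduct_add_cupProduct_swap_eq_zero_of_odd hk hk h h v v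

/-- **Additive induction from `span ℤ S = ⊤`, for an ARBITRARY `Module ℤ` structure** (e.g. the `ModuleCat` structure of `Hᵏ(X; ℤ)`): a predicate
containing `S` and `0` and closed under `+` and `−` holds everywhere.  All `ℤ`-module structures on an abelian group coincide
(`Subsingleton (Module ℤ ·)`), so the `ℤ`-span is the additive closure; this avoids any `ℤ`-scalar algebra on the carrier. Private plumbing. [folklore] -/
private theorem forall_of_span_int_eq_top {M : Type*} [AddCommGroup M] [inst : Module ℤ M] {S : Set M} (hS : Submodule.span ℤ S = ⊤)
    {P : M → Prop} (hmem : ∀ x ∈ S, P x) (h0 : P 0) (hadd : ∀ x y, P x → P y → P (x + y)) (hneg : ∀ x, P x → P (-x)) (x : M) :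
    P x := by
  obtain rfl : inst = AddCommGroup.toIntModule M := Subsingleton.elim _ _
  have hx : x ∈ Submodule.span ℤ S := by
    rw [hS]
    exact Submodule.mem_top
  induction hx using Submodule.span_induction with
  | mem x hx => exact hmem x hx
  | zero => exact h0
  | add x y _ _ hx hy => exact hadd x y hx hy
  | smul a x _ hx =>
    induction a using Int.induction_on with
    | zero =>
      rw [zero_smul]
      exact h0
    | succ i ih =>
      rw [add_smul, one_smul]
      exact hadd _ _ ih hx
    | pred i ih =>
      rw [sub_smul, one_smul, sub_eq_add_neg]
      exact hadd _ _ ih (hneg x hx)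

end CupAlgebra

/-! ### §1 `A(ℂ)` with `ℤ`-coefficients: odd squares vanish, even squares are divisible by `2` -/

namespace AbelianVariety

variable (A : AbelianVariety ℂ)

/-- **`x ⌣ x = 0` FOR EVERY INTEGRAL CLASS OF ODD DEGREE ON A COMPLEX ABELIAN VARIETY**: `x ⌣ x = -(x ⌣ x)` (graded commutativity) and
`H^{2k}(A(ℂ); ℤ)` is torsion-free (`H•(A(ℂ); ℤ) = ⋀• H¹` is free). [cite: HatcherAT2002, §3.2 Thm. 3.11 and Example 3.16]
[cite: Lange2023AbelianVarietiesComplex, §1.1.3 Lemma 1.1.17 (b) (PDF p. 23)] -/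
theorem cupProduct_self_eq_zero_of_odd_int {k n : ℕ} (hk : Odd k) (h : k + k = n) (x : singularCohomology ℤ ℤ (ComplexPoints A.X) k) :
    cupProduct h x x = 0 := by
  have h2 : (2 : ℕ) • cupProduct h x x = 0 := by
    rw [two_nsmul]
    exact cupProduct_self_add_self_eq_zero_of_odd hk h x
  haveI := isTorsionFree_singularCohomology_int A n
  haveI : IsAddTorsionFree (singularCohomology ℤ ℤ (ComplexPoints A.X) n) := IsAddTorsionFree.of_isTorsionFree ℤ _
  exact (smul_eq_zero.1 h2).resolve_left two_ne_zero

/-- **`x ⌣ x ∈ 2·H^{2k}(A(ℂ); ℤ)` FOR EVERY `x ∈ Hᵏ(A(ℂ); ℤ)`, EVERY `k ≥ 1`**: `x ⌣ x = 2y` for some integral class `y` — `Hᵏ(A(ℂ); ℤ)` is spanned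
by cup monomials `v₁ ⌣ ⋯ ⌣ v_k` of degree-one classes, each of square zero, and for `k` even `(x + z)² = x² + z² + 2(x ⌣ z)` (even-degree
classes commute), for `k` odd `x ⌣ x = 0`.  (The squaring map `Hᵏ(A(ℂ); ℤ) → H^{2k}(A(ℂ); ℤ) ⊗ 𝔽₂` vanishes.)
[cite: HatcherAT2002, §3.2 Example 3.16] [cite: Lange2023AbelianVarietiesComplex, §1.1.3 Lemma 1.1.17 (b) and Exercise 1.1.6 (7) (PDF pp. 23, 27)] -/
theorem exists_cupProduct_self_eq_two_nsmul_int {k n : ℕ} (hk0 : k ≠ 0) (h : k + k = n) (x : singularCohomology ℤ ℤ (ComplexPoints A.X) k) :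
    ∃ y : singularCohomology ℤ ℤ (ComplexPoints A.X) n, cupProduct h x x = 2 • y := by
  rcases Nat.even_or_odd k with hev | hodd
  · refine forall_of_span_int_eq_top (span_range_cupPowOne_int A k)
      (P := fun x ↦ ∃ y : singularCohomology ℤ ℤ (ComplexPoints A.X) n, cupProduct h x x = 2 • y) ?_ ?_ ?_ ?_ x
    · rintro _ ⟨v, rfl⟩
      exact ⟨0, by rw [nsmul_zero]; exact cupProduct_cupPowOne_self_eq_zero A hk0 v h⟩
    · exact ⟨0, by simp⟩
    · rintro x z ⟨y₁, hy₁⟩ ⟨y₂, hy₂⟩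
      refine ⟨y₁ + y₂ + cupProduct h x z, ?_⟩
      have hzx : cupProduct h z x = cupProduct h x z := cupProduct_comm_of_even hev h h z x
      simp only [map_add, LinearMap.add_apply, hy₁, hy₂, hzx, smul_add]
      abel
    · rintro x ⟨y, hy⟩
      exact ⟨y, by simp only [map_neg, LinearMap.neg_apply, neg_neg, hy]⟩
  · exact ⟨0, by rw [nsmul_zero]; exact cupProduct_self_eq_zero_of_odd_int A hodd h x⟩

/-- **`(x ⌣ x) ⌣ (x ⌣ x) ∈ 8·H^{4k}(A(ℂ); ℤ)`** for every `x ∈ Hᵏ(A(ℂ); ℤ)`, `k ≥ 1` (`x² = 2y`, `y² = 2z`, so `x⁴ = 4y² = 8z`).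
[cite: HatcherAT2002, §3.2 Example 3.16] [cite: Lange2023AbelianVarietiesComplex, §1.1.3 Lemma 1.1.17 (b) (PDF p. 23)] -/
theorem exists_cupProduct_sq_sq_eq_eight_nsmul_int {k n m : ℕ} (hk0 : k ≠ 0) (h : k + k = n) (h2 : n + n = m)
    (x : singularCohomology ℤ ℤ (ComplexPoints A.X) k) :
    ∃ z : singularCohomology ℤ ℤ (ComplexPoints A.X) m, cupProduct h2 (cupProduct h x x) (cupProduct h x x) = 8 • z := by
  obtain ⟨y, hy⟩ := exists_cupProduct_self_eq_two_nsmul_int A hk0 h x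
  obtain ⟨z, hz⟩ := exists_cupProduct_self_eq_two_nsmul_int A (n := m) (by omega) h2 y
  refine ⟨z, ?_⟩
  calc cupProduct h2 (cupProduct h x x) (cupProduct h x x) = cupProduct h2 (2 • y) (2 • y) := by rw [hy]
    _ = 2 • (2 • cupProduct h2 y y) := by rw [map_nsmul, map_nsmul, LinearMap.smul_apply]
    _ = 2 • (2 • (2 • z)) := by rw [hz]
    _ = 8 • z := by rw [smul_smul, smul_smul]; rfl

/-! ### §2 Pairings: `2 ∣ ⟨x ⌣ x, σ⟩`, `2 ∣ ⟨x ⌣ x, [A(ℂ)]⟩`, `8 ∣ ⟨x⁴, σ⟩` -/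

/-- **`2 ∣ ⟨x ⌣ x, σ⟩` for every integral class `x ∈ Hᵏ(A(ℂ); ℤ)`, `k ≥ 1`, and every homology class `σ ∈ H_{2k}(A(ℂ); ℤ)`.**
[cite: HatcherAT2002, §3.2 Example 3.16 and §3.1 Thm. 3.2] [cite: Lange2023AbelianVarietiesComplex, §1.1.3 Lemma 1.1.17 (b) (PDF p. 23)] -/
theorem two_dvd_kroneckerPairing_cupProduct_self {k n : ℕ} (hk0 : k ≠ 0) (h : k + k = n) (x : singularCohomology ℤ ℤ (ComplexPoints A.X) k)
    (σ : singularHomology ℤ ℤ (ComplexPoints A.X) n) : (2 : ℤ) ∣ kroneckerPairing ℤ ℤ (ComplexPoints A.X) n (cupProduct h x x) σ := by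
  obtain ⟨y, hy⟩ := exists_cupProduct_self_eq_two_nsmul_int A hk0 h x
  exact ⟨kroneckerPairing ℤ ℤ (ComplexPoints A.X) n y σ, by rw [hy, map_nsmul, LinearMap.smul_apply, nsmul_eq_mul, Nat.cast_ofNat]⟩

/-- **`2 ∣ ⟨x ⌣ x, [A(ℂ)]_μ⟩` in the complementary degree** (`k + k = N`, `μ` any homology class of degree `N`, e.g. an orientation class): the
self-intersection number of an integral middle class on an abelian variety is even (all `g ≥ 1`; cf. the lattice statement
`isEven_intersectionForm`). [cite: HatcherAT2002, §3.2 Example 3.16 and §3.3 p. 250] [cite: Lange2023AbelianVarietiesComplex, §1.1.3 Lemma 1.1.17 (b) (PDF p. 23)] -/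
theorem two_dvd_cupPairing_self {k N : ℕ} (hk0 : k ≠ 0) (μ : HomologicalOrientation ℤ (ComplexPoints A.X) N) (hdeg : k + k = N)
    (x : singularCohomology ℤ ℤ (ComplexPoints A.X) k) : (2 : ℤ) ∣ cupPairing μ hdeg x x := by
  rw [cupPairing_apply]
  exact two_dvd_kroneckerPairing_cupProduct_self A hk0 hdeg x μ.fundamentalClass

/-- **`8 ∣ ⟨(x ⌣ x) ⌣ (x ⌣ x), σ⟩`** for every `x ∈ Hᵏ(A(ℂ); ℤ)`, `k ≥ 1`, and every `σ ∈ H_{4k}(A(ℂ); ℤ)`.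
[cite: HatcherAT2002, §3.2 Example 3.16 and §3.1 Thm. 3.2] -/
theorem eight_dvd_kroneckerPairing_cupProduct_sq_sq {k n m : ℕ} (hk0 : k ≠ 0) (h : k + k = n) (h2 : n + n = m)
    (x : singularCohomology ℤ ℤ (ComplexPoints A.X) k) (σ : singularHomology ℤ ℤ (ComplexPoints A.X) m) :
    (8 : ℤ) ∣ kroneckerPairing ℤ ℤ (ComplexPoints A.X) m (cupProduct h2 (cupProduct h x x) (cupProduct h x x)) σ := by
  obtain ⟨z, hz⟩ := exists_cupProduct_sq_sq_eq_eight_nsmul_int A hk0 h h2 x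
  exact ⟨kroneckerPairing ℤ ℤ (ComplexPoints A.X) m z σ, by rw [hz, map_nsmul, LinearMap.smul_apply, nsmul_eq_mul, Nat.cast_ofNat]⟩

/-- **Mixed degrees: `x ⌣ y + y ⌣ x ∈ 2·H` when one degree is even** (then `x ⌣ y = y ⌣ x`), and `= 0` when both are odd — so the symmetrised
product of integral classes on `A(ℂ)` is always divisible by `2`. [cite: HatcherAT2002, §3.2 Thm. 3.11] -/
theorem exists_cupProduct_add_swap_eq_two_nsmul_int {p q n : ℕ} (h : p + q = n) (h' : q + p = n) (x : singularCohomology ℤ ℤ (ComplexPoints A.X) p)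
    (y : singularCohomology ℤ ℤ (ComplexPoints A.X) q) :
    ∃ w : singularCohomology ℤ ℤ (ComplexPoints A.X) n, cupProduct h x y + cupProduct h' y x = 2 • w := by
  rcases Nat.even_or_odd p with hp | hp
  · exact ⟨cupProduct h x y, by rw [← cupProduct_comm_of_even hp h h' x y, two_nsmul]⟩
  · rcases Nat.even_or_odd q with hq | hq
    · exact ⟨cupProduct h x y, by rw [cupProduct_comm_of_even hq h' h y x, two_nsmul]⟩
    · exact ⟨0, by rw [nsmul_zero]; exact cupProduct_add_cupProduct_swap_eq_zero_of_odd hp hq h h' x y⟩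

end AbelianVariety

end Literature.AlgebraicGeometry.HodgeTheory

end
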